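import Summits.BirchSwinnertonDyer.Rank1Residual.Additive.SemistableFieldCriterion
import Summits.BirchSwinnertonDyer.Rank1Residual.Additive.PotentiallyOrdinaryTypeG
import Summits.BirchSwinnertonDyer.Rank1Residual.Additive.DictionaryUniform
import Summits.BirchSwinnertonDyer.Rank1Residual.O6.X3WildOfKMCTorsionFreeMember
import Literature.NumberTheory.EllipticCurves.IsogenyGroundFieldExtension
import Literature.NumberTheory.EllipticCurves.ShafarevichGoodReductionBadPlacesProofs
import HarnessLib

/-!
# Route `KatoDescentTamePotSupersingular` (rung K8, sub-rung B4 (t′), cell `bsd-potss`): the semistability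
# defect `e` is a `ℚ`-ISOGENY INVARIANT at every potentially good `p ≥ 5` (this seat's WANTED W1), and the
# census sub-type (t′) is a property of the `ℚ`-isogeny class. ROUTE-FREE (imports NO `Theses.*` file; a
# `--supports … --as helper` file; seat `bsd-potss-k8t-c4` g5; nothing booked, BSD not proved by any of this)

THE POINT. The b2b cell proved that the semistability defect `e = semistabilityIndex W p = 12 / gcd(12, ord_p Δ_min)`
(for `p ≥ 5` the order of the inertia image, Serre–Tate / Kraus / Serre 1972 §5.6) is constant on the `ℚ`-isogeny
class of a pair of Delbourgo type (G) (`e ∣ p − 1`; `GordIsogenyInvariance.semistabilityIndex_eq_of_isIsogenous_of_typeG`):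
the (G)-field is a subfield of `ℚ(ζ_p)` of degree `e`, and good reduction is an isogeny invariant over it. On the
(t′) cell (`e ∤ p − 1`) no subfield of `ℚ(ζ_p)` has a place of ramification index `e` over `p`; g4's memo
(FINDING-19982-U0-find-v4.2 §5, W1) asked for the missing field. This file supplies it and runs the argument at
EVERY potentially good `p ≥ 5`:

* §1 **`exists_numberField_ramificationIdx_eq`** — for a prime `p` and `n ≥ 1` there is a number field `F` with
  a place `w ∋ p` of ramification index EXACTLY `n`: the root field `F = ℚ[X]/(f)` of an irreducible factor `f`
  of `X^n − p` (`α^n = p`, so `n · ord_w α = e(w|p) ≤ [F : ℚ] ≤ n` by Mathlib's `valuation_liesOver` and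
  `Ideal.ramificationIdx_le_finrank`, forcing `ord_w α = 1` and `e(w|p) = n`). Pure Mathlib.
* §2 **`semistabilityIndex_eq_of_isIsogenous`** (W1) — `p ≥ 5`, `ord_p j(W) ≥ 0`, `W ∼ W'` globally minimal
  ⟹ `e(W') = e(W)`: over the field of §1 with `n = e(W)`, `W_F` is good at `w` (b2b criterion
  `hasGoodReductionAt_baseChange_of_semistabilityIndex_dvd_ramificationIdx`, Silverman *AEC* VII.5.1), the
  isogeny extends to `F` (*AEC* III.§4, `IsIsogenous.extendScalars`) and carries good reduction (*AEC* Cor. VII.7.2,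
  `IsIsogenous.hasGoodReductionAt_iff_of_isIsogenous`), so `e(W') ∣ e(w|p) = e(W)` (b2b
  `semistabilityIndex_dvd_ramificationIdx_of_hasGoodReductionAt`); symmetrically along the dual isogeny. With
  `padicValRat_j_nonneg_of_isIsogenous` (integral `j` transfers, *AEC* VII.5.5) and the `gcd(12, ord_p Δ_min)` form:
  inside a class the Kodaira type at `p` moves at most II ↔ II*, III ↔ III*, IV ↔ IV*.
* §3 **(t′) is a class property at `p ≥ 5`**: `addv_and_subTprime_of_isIsogenous`, `subTprime_iff_of_isIsogenous`
  — every K8-t′ statement quantified over globally minimal (t′) rows may be read at ANY member of the class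
  (the class transport that `TameLowerIntrinsicNonCM` / `TameLowerHalfRankZero` and U-O5′ rely on).

The torsion consequences (W2: no rational `5`-torsion on (t′) classes with `e = 3`) and the reducible-defect node's
trust-base residue are in the sibling file `…TameUpperReducibleTorsionByDefect.lean`. UNCONDITIONAL throughout;
nothing asserted about BSD; NO item is closed.

References: [SilvermanAEC2009] III.§4, VII.1.3, Prop. VII.5.1, proof of Prop. VII.5.4(c), Prop. VII.5.5,
Cor. VII.7.2; [SerreTate1968] §2 Cor. 3; [Serre1972] §5.6 (p. 312: `e = 12 / gcd(12, v(Δ))`);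
[SilvermanATAEC1994] IV.10.4 (`f_p = 2` at an additive `p ≥ 5`).
-/

set_option autoImplicit false
-- the Theorems directory repeats the summit name (sibling precedent `KatoDescentPotSupersingularAssembly.lean`)
set_option linter.dupNamespace false

noncomputable section

open scoped Classical NumberField

namespace Summit.BirchSwinnertonDyer.BirchSwinnertonDyer.Theorems.TameDefectIsogenyInvariance

open WeierstrassCurve IsDedekindDomain IsDedekindDomain.HeightOneSpectrum NumberField Polynomial
  Literature.NumberTheory.EllipticCurves
  Literature.NumberTheory.EllipticCurves.Rank1Residual
  Literature.NumberTheory.EllipticCurves.Rank1Residual.Typed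
  Summit.BirchSwinnertonDyer.Rank1Residual
  Summit.BirchSwinnertonDyer.Rank1Residual.Additive

/-! ## §1 A number field with a place of ramification index exactly `n` over `p` (Kummer) -/

/-- **A place of ramification index exactly `n` over `p`.** For a prime `p` and `n ≥ 1` there is a number field
`F` and a finite place `w` of `F` above `p` with `e(w|p) = n`: take an irreducible factor `f` of `X^n − p` over `ℚ`
and `F = ℚ[X]/(f)`, `α` the class of `X`, so `α^n = p` and `α` is an algebraic integer lying in every prime `w`
above `p`; then `e(w|p) = ord_w(p) = n · ord_w(α) ≥ n` (`valuation_liesOver`) while `e(w|p) ≤ [F : ℚ] = deg f ≤ n`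
(`Ideal.ramificationIdx_le_finrank`), so `e(w|p) = n` (and `f = X^n − p`, `w` is the unique place above `p`,
totally ramified — not needed here). Elementary replacement for "`X^n − p` is Eisenstein at `p`".
[cite: SilvermanAEC2009, VII.5 (proof of Prop. 5.4(c): adjoin a root of a uniformizer)] -/
theorem exists_numberField_ramificationIdx_eq (p : ℕ) [hp : Fact p.Prime] (n : ℕ) (hn : 0 < n) :
    ∃ (F : Type) (_ : Field F) (_ : NumberField F) (w : HeightOneSpectrum (𝓞 F)),
      (p : 𝓞 F) ∈ w.asIdeal ∧ (Ideal.span {(p : ℤ)}).ramificationIdx' w.asIdeal = n := by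
  -- the polynomial `X ^ n - p` and an irreducible factor `f`
  set g : ℚ[X] := X ^ n - C (p : ℚ) with hg
  have hgm : g.Monic := monic_X_pow_sub_C _ hn.ne'
  have hgdeg : g.natDegree = n := natDegree_X_pow_sub_C
  have hg0 : g ≠ 0 := hgm.ne_zero
  have hgu : ¬ IsUnit g := by
    intro hu
    have := natDegree_eq_zero_of_isUnit hu
    omega
  obtain ⟨f, hf, hfg⟩ := WfDvdMonoid.exists_irreducible_factor hgu hg0
  haveI : Fact (Irreducible f) := ⟨hf⟩
  -- the root `α` of `f` in `F = ℚ[X]/(f)` satisfies `α ^ n = p`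
  set F : Type := AdjoinRoot f with hFdef
  set α : F := AdjoinRoot.root f with hαdef
  have hαn : α ^ n = (p : F) := by
    have h1 : AdjoinRoot.mk f g = 0 := AdjoinRoot.mk_eq_zero.mpr hfg
    rw [hg, map_sub, map_pow, AdjoinRoot.mk_X, AdjoinRoot.mk_C, map_natCast, sub_eq_zero] at h1
    exact h1
  -- `α` is an algebraic integer
  have hint : IsIntegral ℤ α := by
    refine ⟨X ^ n - C (p : ℤ), monic_X_pow_sub_C _ hn.ne', ?_⟩
    simp [hαn]
  set α' : 𝓞 F := ⟨α, hint⟩ with hα'def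
  have hα'n : α' ^ n = (p : 𝓞 F) := by
    apply RingOfIntegers.ext
    rw [RingOfIntegers.coe_eq_algebraMap, RingOfIntegers.coe_eq_algebraMap, map_pow, map_natCast,
      hα'def, RingOfIntegers.map_mk, hαn]
  have hp0' : (p : 𝓞 F) ≠ 0 := Nat.cast_ne_zero.mpr hp.out.ne_zero
  have hα'0 : α' ≠ 0 := by
    intro h0
    rw [h0, zero_pow hn.ne'] at hα'n
    exact hp0' hα'n.symm
  -- the place `v = (p)` of `ℤ` and a place `w` of `F` above it
  set v : HeightOneSpectrum ℤ := (Rat.HeightOneSpectrum.primesEquiv (R := ℤ)).symm ⟨p, hp.out⟩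
    with hvdef
  have hv : Rat.HeightOneSpectrum.natGenerator v = p :=
    congrArg Subtype.val ((Rat.HeightOneSpectrum.primesEquiv (R := ℤ)).apply_symm_apply ⟨p, hp.out⟩)
  have hvspan : v.asIdeal = Ideal.span {(p : ℤ)} := by
    rw [Rat.HeightOneSpectrum.asIdeal_eq_span_natGenerator_int, hv]
  haveI := v.isMaximal
  obtain ⟨Q, hQmax, hQover⟩ :=
    Ideal.exists_maximal_ideal_liesOver_of_isIntegral (S := 𝓞 F) v.asIdeal
  have hpQ : (p : 𝓞 F) ∈ Q := by
    have h1 : (p : ℤ) ∈ Q.under ℤ := by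
      rw [← hQover.over, hvspan]; exact Ideal.mem_span_singleton_self _
    rw [Ideal.under_def, Ideal.mem_comap, map_natCast] at h1
    exact h1
  have hQ0 : Q ≠ ⊥ := fun h ↦ hp0' (by rw [h, Ideal.mem_bot] at hpQ; exact hpQ)
  set w : HeightOneSpectrum (𝓞 F) := ⟨Q, hQmax.isPrime, hQ0⟩ with hwdef
  haveI hlies : w.asIdeal.LiesOver v.asIdeal := hQover
  have hα'w : α' ∈ w.asIdeal := hQmax.isPrime.mem_of_pow_mem n (by rw [hα'n]; exact hpQ)
  -- `ord_w(α) ≥ 1`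
  set m : ℕ := multiplicity w.asIdeal (Ideal.span {α'}) with hmdef
  have hwα : w.intValuation α' = WithZero.exp (-(m : ℤ)) := intValuation_eq_exp_neg_multiplicity w hα'0
  have hm1 : 1 ≤ m := by
    have hlt := (intValuation_lt_one_iff_mem w α').mpr hα'w
    rw [hwα, ← WithZero.exp_zero, WithZero.exp_lt_exp] at hlt
    omega
  -- `e(w|p) = n · ord_w(α)`
  have hval := valuation_liesOver (K := ℚ) (L := F) v w (p : ℚ)
  have hvp : v.valuation ℚ (p : ℚ) = WithZero.exp (-1 : ℤ) := by
    rw [← hv]; exact Rat.HeightOneSpectrum.valuation_natGenerator_int v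
  have hwp : w.valuation F (algebraMap ℚ F p) = WithZero.exp (-((n * m : ℕ) : ℤ)) := by
    rw [map_natCast, ← hαn, map_pow, show (α : F) = algebraMap (𝓞 F) F α' from rfl,
      valuation_of_algebraMap, hwα, ← WithZero.exp_nsmul]
    congr 1
    push_cast
    ring
  rw [hvp, hwp, ← WithZero.exp_nsmul, WithZero.exp_inj] at hval
  have he : v.asIdeal.ramificationIdx' w.asIdeal = n * m := by
    have : ((v.asIdeal.ramificationIdx' w.asIdeal : ℕ) : ℤ) = ((n * m : ℕ) : ℤ) := by
      simp only [nsmul_eq_mul, mul_neg, mul_one] at hval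
      linarith
    exact_mod_cast this
  -- `e(w|p) ≤ [F : ℚ] ≤ n`
  haveI := w.isPrime
  have hle : v.asIdeal.ramificationIdx' w.asIdeal ≤ Module.finrank ℚ F :=
    Ideal.ramificationIdx_le_finrank (𝓞 F) ℚ F w.asIdeal
  have hfin : Module.finrank ℚ F ≤ n := by
    have h1 : Module.finrank ℚ F = f.natDegree :=
      finrank_quotient_span_eq_natDegree (K := ℚ) (f := f)
    rw [h1, ← hgdeg]
    exact natDegree_le_of_dvd hfg hg0
  have hmn : n * m ≤ n := by rw [← he]; exact hle.trans hfin
  have hm : m = 1 := by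
    have hm' : m ≤ 1 := by
      by_contra h
      push Not at h
      nlinarith
    omega
  refine ⟨F, inferInstance, inferInstance, w, hpQ, ?_⟩
  rw [← hvspan, he, hm, mul_one]

/-! ## §2 W1: the semistability defect is a `ℚ`-isogeny invariant at every potentially good `p ≥ 5` -/

section Defect

variable {W W' : WeierstrassCurve ℚ} [W.IsElliptic] [W.IsGloballyMinimal] [W'.IsElliptic]
  {p : ℕ} [hp : Fact p.Prime]

omit [W.IsElliptic] hp in
variable (W p) in
/-- The semistability defect `12 / gcd(12, ord_p Δ_min)` is positive. [folklore] -/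
theorem semistabilityIndex_pos : 0 < semistabilityIndex W p := by
  unfold semistabilityIndex
  exact Nat.div_pos (Nat.le_of_dvd (by norm_num) (Nat.gcd_dvd_left _ _))
    (Nat.gcd_pos_of_pos_left _ (by norm_num))

variable (W p) in
/-- **A semistabilising place of the EXACT index.** At a potentially good `p ≥ 5` (`ord_p j ≥ 0`, `W` globally
minimal) there is a number field `F` and a place `w ∋ p` with `e(w|p) = semistabilityIndex W p` at which `W_F`
has GOOD reduction (§1 with `n = e`, then the b2b criterion "good at `w` iff `e ∣ e(w|p)`", Silverman *AEC*
VII.5.1). [cite: SilvermanAEC2009, Prop. VII.5.1 and proof of Prop. VII.5.4(c)] -/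
theorem exists_place_ramificationIdx_eq_semistabilityIndex_hasGoodReductionAt (hp5 : 5 ≤ p)
    (hj : 0 ≤ padicValRat p W.j) :
    ∃ (F : Type) (_ : Field F) (_ : NumberField F) (w : HeightOneSpectrum (𝓞 F)),
      (p : 𝓞 F) ∈ w.asIdeal ∧ (Ideal.span {(p : ℤ)}).ramificationIdx' w.asIdeal = semistabilityIndex W p ∧
        (W.baseChange F).HasGoodReductionAt w := by
  obtain ⟨F, iF, iN, w, hw, he⟩ :=
    exists_numberField_ramificationIdx_eq p (semistabilityIndex W p) (semistabilityIndex_pos W p)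
  exact ⟨F, iF, iN, w, hw, he,
    hasGoodReductionAt_baseChange_of_semistabilityIndex_dvd_ramificationIdx W p F w hp5 hj hw
      (dvd_of_eq he.symm)⟩

/-- **Integral `j` transfers along every `ℚ`-isogeny** at `p ≥ 5`: `ord_p j(W) ≥ 0` and `W ∼ W'` give
`ord_p j(W') ≥ 0` — `W_F` is good at the place of the previous theorem, so is the `F`-isogenous `W'_F`
(*AEC* III.§4, Cor. VII.7.2), and good reduction upstairs forces integral `j` (*AEC* VII.5.5, b2b
`padicValRat_j_nonneg_of_hasGoodReductionAt_baseChange`). Any models (only `W` globally minimal).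
[cite: SilvermanAEC2009, Cor. VII.7.2 and Prop. VII.5.5] -/
theorem padicValRat_j_nonneg_of_isIsogenous (hp5 : 5 ≤ p) (hj : 0 ≤ padicValRat p W.j)
    (h : IsIsogenous W W') : 0 ≤ padicValRat p W'.j := by
  obtain ⟨F, iF, iN, w, hw, -, hgood⟩ :=
    exists_place_ramificationIdx_eq_semistabilityIndex_hasGoodReductionAt W p hp5 hj
  haveI : (W.baseChange F).IsElliptic := by rw [baseChange]; infer_instance
  haveI : (W'.baseChange F).IsElliptic := by rw [baseChange]; infer_instance
  have hiso : IsIsogenous (W.baseChange F) (W'.baseChange F) := h.extendScalars F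
  exact Additive.padicValRat_j_nonneg_of_hasGoodReductionAt_baseChange W' p hw
    ((hiso.hasGoodReductionAt_iff_of_isIsogenous w).mp hgood)

variable [W'.IsGloballyMinimal]

/-- One direction of W1: `p ≥ 5`, `ord_p j(W) ≥ 0`, `W ∼ W'` (globally minimal models) ⟹
**`e(W') ∣ e(W)`** — `W'_F` is good at the place `w` with `e(w|p) = e(W)` of
`exists_place_ramificationIdx_eq_semistabilityIndex_hasGoodReductionAt` (the isogeny extends to `F` and carries
good reduction, *AEC* III.§4 + Cor. VII.7.2), and the defect of `W'` divides the ramification index of any place of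
good reduction (b2b `semistabilityIndex_dvd_ramificationIdx_of_hasGoodReductionAt`, *AEC* VII.1.3).
[cite: SilvermanAEC2009, Prop. VII.5.1, Cor. VII.7.2] [cite: SerreTate1968, §2 Cor. 3] -/
theorem semistabilityIndex_dvd_of_isIsogenous (hp5 : 5 ≤ p) (hj : 0 ≤ padicValRat p W.j)
    (h : IsIsogenous W W') : semistabilityIndex W' p ∣ semistabilityIndex W p := by
  obtain ⟨F, iF, iN, w, hw, he, hgood⟩ :=
    exists_place_ramificationIdx_eq_semistabilityIndex_hasGoodReductionAt W p hp5 hj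
  haveI : (W.baseChange F).IsElliptic := by rw [baseChange]; infer_instance
  haveI : (W'.baseChange F).IsElliptic := by rw [baseChange]; infer_instance
  have hiso : IsIsogenous (W.baseChange F) (W'.baseChange F) := h.extendScalars F
  rw [← he]
  exact semistabilityIndex_dvd_ramificationIdx_of_hasGoodReductionAt W' p F w hw
    ((hiso.hasGoodReductionAt_iff_of_isIsogenous w).mp hgood)

/-- **W1 — the semistability defect is a `ℚ`-isogeny invariant at every potentially good `p ≥ 5`**:
`ord_p j(W) ≥ 0`, `W ∼ W'` (globally minimal models) ⟹ `semistabilityIndex W' p = semistabilityIndex W p`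
(`e ∈ {1, 2, 3, 4, 6}`, the order of the inertia image — constant on the class because `V_ℓ` is; here by the
valuation-theoretic criterion over a Kummer field, both divisibilities by `semistabilityIndex_dvd_of_isIsogenous`,
the second along the dual isogeny with `padicValRat_j_nonneg_of_isIsogenous`). Extends b2b's
`semistabilityIndex_eq_of_isIsogenous_of_typeG` from the (G)-cell (`e ∣ p − 1`) to (t′).
[cite: SilvermanAEC2009, Prop. VII.5.1, Cor. VII.7.2] [cite: SerreTate1968, §2 Cor. 3] [cite: Serre1972, §5.6 (p. 312)] -/
theorem semistabilityIndex_eq_of_isIsogenous (hp5 : 5 ≤ p) (hj : 0 ≤ padicValRat p W.j)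
    (h : IsIsogenous W W') : semistabilityIndex W' p = semistabilityIndex W p :=
  Nat.dvd_antisymm (semistabilityIndex_dvd_of_isIsogenous hp5 hj h)
    (semistabilityIndex_dvd_of_isIsogenous hp5 (padicValRat_j_nonneg_of_isIsogenous hp5 hj h)
      h.symm_of_charZero)

/-- **`gcd(12, ord_p Δ_min)` is a `ℚ`-isogeny invariant at every potentially good `p ≥ 5`** — the form of W1 on
the minimal discriminants: inside a class the Kodaira type at `p` moves at most between II and II* (`e = 6`),
III and III* (`e = 4`), IV and IV* (`e = 3`), and stays I₀* (`e = 2`) or I₀ (`e = 1`).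
[cite: SilvermanAEC2009, Prop. VII.5.1, Cor. VII.7.2] [cite: Serre1972, §5.6 (p. 312)] -/
theorem gcd_padicValInt_minimalDiscriminantInt_eq_of_isIsogenous (hp5 : 5 ≤ p)
    (hj : 0 ≤ padicValRat p W.j) (h : IsIsogenous W W') :
    Nat.gcd 12 (padicValInt p W'.minimalDiscriminantInt) =
      Nat.gcd 12 (padicValInt p W.minimalDiscriminantInt) := by
  have he := semistabilityIndex_eq_of_isIsogenous hp5 hj h
  unfold semistabilityIndex at he
  set g := Nat.gcd 12 (padicValInt p W.minimalDiscriminantInt) with hg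
  set g' := Nat.gcd 12 (padicValInt p W'.minimalDiscriminantInt) with hg'
  have hd : g ∣ 12 := Nat.gcd_dvd_left _ _
  have hd' : g' ∣ 12 := Nat.gcd_dvd_left _ _
  have hpos : 0 < g := Nat.gcd_pos_of_pos_left _ (by norm_num)
  have hq : 0 < 12 / g := Nat.div_pos (Nat.le_of_dvd (by norm_num) hd) hpos
  have h1 : 12 / g' * g' = 12 := Nat.div_mul_cancel hd'
  have h2 : 12 / g * g = 12 := Nat.div_mul_cancel hd
  rw [he] at h1
  exact Nat.eq_of_mul_eq_mul_left hq (h1.trans h2.symm)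

end Defect

/-! ## §3 (t′) is a property of the `ℚ`-isogeny class (`p ≥ 5`) -/

section Tprime

variable {W W' : WeierstrassCurve ℚ} [W.IsElliptic] [W.IsGloballyMinimal] [W'.IsElliptic]
  [W'.IsGloballyMinimal] {p : ℕ} [hp : Fact p.Prime]

/-- **(t′) transfers along every `ℚ`-isogeny at `p ≥ 5`**: `W` additive of census sub-type (t′) at `p`
(`¬(M)`, `f_p = 2`, `e ∤ p − 1`) and `W ∼ W'` (globally minimal) ⟹ `W'` is additive of sub-type (t′) at `p` —
additivity with integral `j` transfers (`Addv.of_isIsogenous_of_padicValRat_j_nonneg`, *AEC* VII.7.2/VII.5.5),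
`f_p = 2` is automatic at an additive `p ≥ 5` (b2b `condExpTwo_of_addv_of_five_le`), and `e` is a class invariant
(§2). [cite: SilvermanAEC2009, Cor. VII.7.2, Prop. VII.5.5] [cite: SilvermanATAEC1994, IV.10.4] -/
theorem addv_and_subTprime_of_isIsogenous (hp5 : 5 ≤ p) (hadd : Addv W p) (hT : SubTprime W p)
    (h : IsIsogenous W W') : Addv W' p ∧ SubTprime W' p := by
  have hj : 0 ≤ padicValRat p W.j := not_lt.mp hT.1
  obtain ⟨hadd', hj'⟩ := Addv.of_isIsogenous_of_padicValRat_j_nonneg (p := p) hadd hj h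
  refine ⟨hadd', not_lt.mpr hj', condExpTwo_of_addv_of_five_le W' p hp5 hadd', ?_⟩
  rw [semistabilityIndex_eq_of_isIsogenous hp5 hj h]
  exact hT.2.2

/-- **(t′) is constant on `ℚ`-isogeny classes at `p ≥ 5`** (given additivity of one member):
`SubTprime W p ↔ SubTprime W' p` for `W ∼ W'` globally minimal, `W` additive at `p`.
[cite: SilvermanAEC2009, Cor. VII.7.2, Prop. VII.5.5] -/
theorem subTprime_iff_of_isIsogenous (hp5 : 5 ≤ p) (hadd : Addv W p) (h : IsIsogenous W W') :
    SubTprime W p ↔ SubTprime W' p := by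
  refine ⟨fun hT ↦ (addv_and_subTprime_of_isIsogenous hp5 hadd hT h).2, fun hT' ↦ ?_⟩
  -- backwards: `W'` is additive too (additivity alone transfers when `ord_p j(W') ≥ 0`)
  have hj' : 0 ≤ padicValRat p W'.j := not_lt.mp hT'.1
  have hj : 0 ≤ padicValRat p W.j := padicValRat_j_nonneg_of_isIsogenous hp5 hj' h.symm_of_charZero
  refine ⟨not_lt.mpr hj, condExpTwo_of_addv_of_five_le W p hp5 hadd, ?_⟩
  rw [← semistabilityIndex_eq_of_isIsogenous hp5 hj h]
  exact hT'.2.2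

end Tprime

end Summit.BirchSwinnertonDyer.BirchSwinnertonDyer.Theorems.TameDefectIsogenyInvariance

end
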